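import Mathlib
import Literature.MathematicalPhysics.QuantumFieldTheory.Balaban1983to89.Beta.GaussianIntegral
import Literature.MathematicalPhysics.QuantumFieldTheory.Balaban1983to89.B14LogDet336Matrix

/-!
# `Balaban1983to89.B14GaussianDet333` — T. Bałaban, *Convergent renormalization expansions for lattice gauge theories*,
# Commun. Math. Phys. **119** (1988) 243–285 [Balaban1988Convergent]: (3.33) p. 273, the Gaussian normalization
# (determinant) identity of the k+1-st step, TYPED AS PRINTED AND PROVED in every finite dimension

statement-level skeleton of published theorems with citation tags; proofs where landed; nothing here is a claim about the Yang–Mills mass gap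

PDF held: `paper:balaban1988-cmp119-convergent-renormalization` (journal page = PDF page + 242); the display was read on
the x2 render `…-p031-x2.png` (p. 273) of `run/shared/lean/pub/pub-balaban/b2b-balaban-ref1/pages/1988-cmp119-…/`, the OCR
layer of the held text being used for orientation only (it garbles (3.33)).

CITATION HEADER (lean-in-tree rule).  WHAT IS REPRODUCED, verbatim, p. 273 [PDF 31]: *"Consider now the first logarithm
on the right-hand side of (3.30). The factor z^{(k)} comes from elimination of the δ-functions, and is equal to the product
of the factors z^{(k)}(c) for c ∈ Λ^{(k+1)}_{k+1}. We have
log\[z^{(k)} ∫ dA exp\[−½⟨A, C\*Δ^{(k)}CA⟩\]\] = Σ_{c∈Λ^{(k+1)}_{k+1}} log z^{(k)}(c) − ½ log det(C\*Δ^{(k)}C)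
  + log ∫ dA exp\[−½|A|²\]. (3.33)
The last term is a number, which contributes to the vacuum energy renormalization, so we include it into the definition of
E₀^{(k)}. The first term has already the localized form, so we consider the second term."* — SKELETON row **B14.Eq3.33**
(the (3.33) part of the combined Phase-1 row `B14.Eq3.33–3.36`; (3.34)₁/(3.35)/(3.36) are the sibling module
`…B14LogDet336Matrix`, (3.35) also `…B14Sect3.resolvent_identity_335`).

READING NOTE (this unit, gen 2).  The Phase-1 inventory row (ROWS-B14 v1.3, written from the OCR layer) described (3.33)
as a "Gaussian integral with source … + ⟨f, A⟩?" with a question mark, and PHASE2-TARGETS §G.3 / PHASE2-PACKETS p28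
inherited that reading.  The page image shows NO source term: (3.33) is the normalization identity above (Gaussian integral
of the positive form `⟨A, C*Δ^{(k)}CA⟩` = `det^{−1/2}` × the isotropic Gaussian integral, in logarithmic form, with the
δ-elimination factor `z^{(k)} = Π_c z^{(k)}(c)` split off as a sum of logarithms).  ROWS-B14 v1.4 corrects the row text.

THE MODEL (the one of `…B14LogDet336Matrix`): the positive operator `C*Δ^{(k)}C` on the finite-dimensional space of
fluctuation-field configurations `A` (variables on `Λ^{(k)*}_{k+1}`, p. 268) is a positive definite real symmetric matrix
`T` on a finite index type `n`; `dA` is Lebesgue (= product) measure `volume` on `n → ℝ`; `⟨A, TA⟩ = A ⬝ᵥ T *ᵥ A`,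
`|A|² = A ⬝ᵥ A`; the factors `z^{(k)}(c) > 0` are an arbitrary finite family of positive reals indexed by `c ∈ s`.
Positivity of `C*Δ^{(k)}C` is the paper's standing fact used (uncited) at this point (p. 273 takes `log` and a contour
around a spectrum in `Re z > r > 0`; cell GAPS.md G-B14s-11) — it is the HYPOTHESIS `hT : T.PosDef` here.

WHAT IS PROVED (kernel-checked, 0 sorry; every hypothesis displayed):
* `integral_exp_neg_half_quadForm_eq_inv_sqrt_det_mul` — the exponentiated content of (3.33):
  `∫ exp(−½⟨A,TA⟩) dA = (√det T)⁻¹ · ∫ exp(−½|A|²) dA`, from the tree's kernel theorems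
  `Beta.GaussianIntegral.integral_exp_neg_half_quadForm` (`= √(2π)^{|n|}/√det T`, by `T = BᵀB` and the linear change of
  variables `∫ f(Bv) dv = |det B|⁻¹ ∫ f`) and `Beta.GaussianIntegral.integral_exp_neg_half_dotProduct_self`
  (`∫ exp(−½|A|²) dA = √(2π)^{|n|}`), which this file re-uses BY NAME and does not restate;
* `integral_exp_neg_half_quadForm_pos` — the integral is positive (so its logarithm is the honest one);
* `eq333` — (3.33) AS PRINTED: for positive `z(c)`, `c ∈ s`,
  `log((Π_{c∈s} z(c)) · ∫ exp(−½⟨A,TA⟩) dA) = Σ_{c∈s} log z(c) − ½ log det T + log ∫ exp(−½|A|²) dA`;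
* `eq333_const` — "the last term is a number": `log ∫ exp(−½|A|²) dA = (|n|/2)·log 2π`;
* `eq333_trace` — (3.33) continued by (3.34)₁ (`…B14LogDet336Matrix.log_det_eq_trace_log`): the middle term is
  `−½ Tr log T`.

WHAT IS NOT ASSERTED: the operators `C`, `Δ^{(k)}`, the δ-elimination producing `z^{(k)}` (B10 (14)–(18), B12 (1.8)), the
identification of `E₀^{(k)}`, anything about (3.30)–(3.32) or (3.37)–(3.38).  Value = kernel certificate of the printed
Gaussian identity in every finite dimension, NOT summit progress.  Mega-formalization `lit-balaban`, unit `lit-balaban-r11`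
gen 2 = Phase-2 seat p28 (PHASE2-TARGETS §G.3), HOME `run/shared/lean/pub/lit-balaban/`.

## References
* [Balaban1988Convergent] T. Bałaban, Commun. Math. Phys. 119 (1988) 243–285, (3.33) p. 273.
-/

noncomputable section

open MeasureTheory Matrix Finset
open scoped Real

namespace Literature.MathematicalPhysics.QuantumFieldTheory.Balaban1983to89.B14.GaussianDet333

open Literature.MathematicalPhysics.QuantumFieldTheory.Balaban1983to89
open Literature.MathematicalPhysics.QuantumFieldTheory.Balaban1983to89.Beta (GaussianIntegral.integral_exp_neg_half_quadForm
  GaussianIntegral.integral_exp_neg_half_dotProduct_self)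

variable {n : Type*} [Fintype n] [DecidableEq n] {T : Matrix n n ℝ}

omit [DecidableEq n] in
/-- "The last term is a number" (p. 273, after (3.33)): the isotropic Gaussian integral `∫ dA exp[−½|A|²]` over the
`|n|`-dimensional configuration space is positive (its value is `√(2π)^{|n|}`,
`Beta.GaussianIntegral.integral_exp_neg_half_dotProduct_self`). [cite: Balaban1988Convergent, (3.33) p.273] -/
theorem integral_exp_neg_half_sq_pos : 0 < ∫ A : n → ℝ, Real.exp (-(1/2 : ℝ) * (A ⬝ᵥ A)) := by
  rw [GaussianIntegral.integral_exp_neg_half_dotProduct_self]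
  exact pow_pos (Real.sqrt_pos.2 (by positivity)) _

omit [DecidableEq n] in
/-- "The last term is a number, which contributes to the vacuum energy renormalization" (p. 273): explicitly
`log ∫ dA exp[−½|A|²] = (|n|/2)·log 2π`, `|n|` the number of real variables integrated over.
[cite: Balaban1988Convergent, (3.33) p.273] -/
theorem eq333_const :
    Real.log (∫ A : n → ℝ, Real.exp (-(1/2 : ℝ) * (A ⬝ᵥ A))) = (Fintype.card n : ℝ) / 2 * Real.log (2 * π) := by
  rw [GaussianIntegral.integral_exp_neg_half_dotProduct_self, Real.log_pow, Real.log_sqrt (by positivity)]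
  ring

/-- The exponentiated content of **(3.33)** p. 273: for the positive operator `T = C*Δ^{(k)}C` (hypothesis `hT`),
`∫ dA exp[−½⟨A, TA⟩] = (det T)^{−1/2} · ∫ dA exp[−½|A|²]` — the Gaussian integral of the positive form is the isotropic
one divided by `√det T` (linear change of variables `A ↦ BA`, `T = BᵀB`; from the tree's
`Beta.GaussianIntegral.integral_exp_neg_half_quadForm`). [cite: Balaban1988Convergent, (3.33) p.273] -/
theorem integral_exp_neg_half_quadForm_eq_inv_sqrt_det_mul (hT : T.PosDef) :
    ∫ A : n → ℝ, Real.exp (-(1/2 : ℝ) * (A ⬝ᵥ T *ᵥ A)) =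
      (Real.sqrt T.det)⁻¹ * ∫ A : n → ℝ, Real.exp (-(1/2 : ℝ) * (A ⬝ᵥ A)) := by
  rw [GaussianIntegral.integral_exp_neg_half_quadForm T hT, GaussianIntegral.integral_exp_neg_half_dotProduct_self,
    div_eq_inv_mul]

/-- Positivity of the Gaussian integral of the positive form `⟨A, C*Δ^{(k)}CA⟩` (so that the logarithm in (3.33) is taken
of a positive number). [cite: Balaban1988Convergent, (3.33) p.273] -/
theorem integral_exp_neg_half_quadForm_pos (hT : T.PosDef) :
    0 < ∫ A : n → ℝ, Real.exp (-(1/2 : ℝ) * (A ⬝ᵥ T *ᵥ A)) := by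
  rw [integral_exp_neg_half_quadForm_eq_inv_sqrt_det_mul hT]
  exact mul_pos (inv_pos.2 (Real.sqrt_pos.2 hT.det_pos)) integral_exp_neg_half_sq_pos

/-- **(3.33)** p. 273 [PDF 31], verbatim: *"The factor z^{(k)} … is equal to the product of the factors z^{(k)}(c) for
c ∈ Λ^{(k+1)}_{k+1}. We have log\[z^{(k)} ∫ dA exp\[−½⟨A, C\*Δ^{(k)}CA⟩\]\] = Σ_{c∈Λ^{(k+1)}_{k+1}} log z^{(k)}(c)
− ½ log det(C\*Δ^{(k)}C) + log ∫ dA exp\[−½|A|²\]. (3.33)"* — typed reading: `T = C*Δ^{(k)}C` a positive definite real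
symmetric matrix on the finite index type `n` of the variables `A` (hypothesis `hT`), `dA` = Lebesgue measure on `n → ℝ`,
`z^{(k)} = Π_{c∈s} z(c)` with every `z(c) > 0` (hypothesis `hz`; `s` = the finite set `Λ^{(k+1)}_{k+1}`).
[cite: Balaban1988Convergent, (3.33) p.273] -/
theorem eq333 (hT : T.PosDef) {ι : Type*} (s : Finset ι) (z : ι → ℝ) (hz : ∀ c ∈ s, 0 < z c) :
    Real.log ((∏ c ∈ s, z c) * ∫ A : n → ℝ, Real.exp (-(1/2 : ℝ) * (A ⬝ᵥ T *ᵥ A))) =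
      ∑ c ∈ s, Real.log (z c) - (1/2 : ℝ) * Real.log T.det
        + Real.log (∫ A : n → ℝ, Real.exp (-(1/2 : ℝ) * (A ⬝ᵥ A))) := by
  have hprod : 0 < ∏ c ∈ s, z c := Finset.prod_pos hz
  have hI := integral_exp_neg_half_quadForm_pos hT
  rw [Real.log_mul hprod.ne' hI.ne', Real.log_prod (hf := fun c hc => (hz c hc).ne'),
    integral_exp_neg_half_quadForm_eq_inv_sqrt_det_mul hT,
    Real.log_mul (inv_pos.2 (Real.sqrt_pos.2 hT.det_pos)).ne' integral_exp_neg_half_sq_pos.ne',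
    Real.log_inv, Real.log_sqrt hT.det_pos.le]
  ring

/-- (3.33) with its constant evaluated: `log(z^{(k)} ∫ dA exp[−½⟨A,TA⟩]) = Σ_c log z^{(k)}(c) − ½ log det T + (|n|/2) log 2π`.
[cite: Balaban1988Convergent, (3.33) p.273] -/
theorem eq333_explicit (hT : T.PosDef) {ι : Type*} (s : Finset ι) (z : ι → ℝ) (hz : ∀ c ∈ s, 0 < z c) :
    Real.log ((∏ c ∈ s, z c) * ∫ A : n → ℝ, Real.exp (-(1/2 : ℝ) * (A ⬝ᵥ T *ᵥ A))) =
      ∑ c ∈ s, Real.log (z c) - (1/2 : ℝ) * Real.log T.det + (Fintype.card n : ℝ) / 2 * Real.log (2 * π) := by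
  rw [eq333 hT s z hz, eq333_const]

/-- (3.33) continued by (3.34)₁ p. 273 (*"− ½ log det(C\*Δ^{(k)}C) = − ½ Tr log(C\*Δ^{(k)}C)"*, the sibling module's
`B14LogDet336Matrix.log_det_eq_trace_log`, `log T = cfc Real.log T`):
`log(z^{(k)} ∫ dA exp[−½⟨A,TA⟩]) = Σ_c log z^{(k)}(c) − ½ Tr log T + log ∫ dA exp[−½|A|²]`.
[cite: Balaban1988Convergent, (3.33)–(3.34) p.273] -/
theorem eq333_trace (hT : T.PosDef) {ι : Type*} (s : Finset ι) (z : ι → ℝ) (hz : ∀ c ∈ s, 0 < z c) :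
    Real.log ((∏ c ∈ s, z c) * ∫ A : n → ℝ, Real.exp (-(1/2 : ℝ) * (A ⬝ᵥ T *ᵥ A))) =
      ∑ c ∈ s, Real.log (z c) - (1/2 : ℝ) * trace (cfc Real.log T)
        + Real.log (∫ A : n → ℝ, Real.exp (-(1/2 : ℝ) * (A ⬝ᵥ A))) := by
  rw [eq333 hT s z hz, B14LogDet336Matrix.log_det_eq_trace_log hT]

end Literature.MathematicalPhysics.QuantumFieldTheory.Balaban1983to89.B14.GaussianDet333
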